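import Literature.Analysis.Complex.CauchyTransformHolderExtension
import Literature.Analysis.FunctionSpaces.ContDiffHolderComposition
import Literature.Analysis.FunctionSpaces.ContDiffHolderFDerivCLM
import Literature.Analysis.FunctionSpaces.ContDiffHolderOne
import HarnessLib

/-!
# The Cauchy transform `C^{k,r}_c → C^{k+1,r}_b` (higher order, bundled form)

For a finite-dimensional complex Banach space `F`, `0 < r < 1` and the one-variable Cauchy
transform `T g = cauchyTransformAlong 1 g`, `(T g)(z) = ∫ (π t)⁻¹ • g (z - t) dA(t)`
(`Literature/Analysis/Complex/CauchyTransform.lean`), assume the a priori `C^{1,r}` estimate for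
smooth densities in a disc (`CauchyTransformHolderApriori F r`,
`Literature/Analysis/Complex/CauchyTransformHolderExtension.lean`). Then for every `k : ℕ` and every
radius `ρ > 0` there is `C ≥ 0` such that for every `g` in the Banach space
`C^{k,r}_b(ℂ, F) = ContDiffHolderFunction ℂ F k r` vanishing for `‖z‖ ≥ ρ`:

* `T g ∈ C^{k+1,r}_b` with `‖T g‖_{C^{k+1,r}} ≤ C ‖g‖_{C^{k,r}}`;
* `∂̄ (T g) = g`;
* `T g → 0` at infinity

(`cauchyTransform_contDiffHolder_succ`). This is the classical boundedness of `T` from `C^{k,r}`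
densities supported in a fixed disc to `C^{k+1,r}` (Vekua 1962, Ch. I, §5–§6 for `k = 0`; the
higher-order statement by differentiating under the integral sign).

Proof by induction on `k`. The case `k = 0` is `cauchyTransform_holder_of_apriori` repackaged with
`K₀ = K₁ = ‖g‖_{C^{0,r}}` through the `k = 1` dictionary
(`Literature.Analysis.FunctionSpaces.memContDiffHolder_one_of_bounds`,
`eContDiffHolderNorm_one_le_of_bounds`). For the step, `g ∈ C^{k+1,r}_b ⊆ C¹_c`, so
`D(T g)(z)[w] = T(Dg[w])(z)` (`fderiv_cauchyTransformAlong_apply`); an `ℝ`-linear map on `ℂ` is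
determined by its values at `1` and `I`, whence
`D(T g) = re(·) • T(Dg 1) + im(·) • T(Dg I)` (`fderiv_cauchyTransform_eq_smulRight`), the two
densities `z ↦ Dg(z) 1`, `z ↦ Dg(z) I` lying in `C^{k,r}_b` with norm `≤ ‖g‖_{C^{k+1,r}}` and
vanishing off the disc; the induction hypothesis puts `D(T g)` in `C^{k+1,r}_b`, and together
with the sup bound `‖T g‖ ≤ 6 ρ ‖g‖` (`norm_cauchyTransform_le_uniform`) this is membership in
`C^{k+2,r}_b` (`memContDiffHolder_succ_iff`, `eContDiffHolderNorm_succ_eq_fderiv`). The decay at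
infinity is the elementary far bound `‖(T g)(w)‖ ≤ 2 ρ² ‖g‖_∞ / ‖w‖` for `‖w‖ ≥ 2ρ`
(`norm_cauchyTransform_le_div_norm`).

## References

* I. N. Vekua, *Generalized Analytic Functions* (1962), Ch. I, §5–§6.
* L. Hörmander, *An Introduction to Complex Analysis in Several Variables*, 2nd ed. (1973),
  Thm. 1.2.2. [HormanderSCV1973]
* D. Gilbarg, N. S. Trudinger, *Elliptic Partial Differential Equations of Second Order* (2001),
  §4.1. [GilbargTrudinger2001]
-/

noncomputable section

open Set Metric MeasureTheory Filter Function Complex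
open scoped NNReal ENNReal Topology

namespace Literature.Analysis.Complex

open Literature.Analysis.FunctionSpaces

/-! ### Decay at infinity -/

section Decay

variable {F : Type*} [NormedAddCommGroup F] [NormedSpace ℂ F]

/-- **Far decay of the Cauchy transform of a density supported in a disc.** If `‖h‖ ≤ G` and `h`
vanishes where `R ≤ ‖z‖` (`0 < R`), then `‖(T h)(w)‖ ≤ 2 R² G / ‖w‖` for `‖w‖ ≥ 2R`: the integrand
`(π t)⁻¹ h (w - t)` lives on the disc `‖t - w‖ < R`, of area `π R²`, where `‖t‖ ≥ ‖w‖ / 2`.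
[folklore] -/
theorem norm_cauchyTransform_le_div_norm {h : ℂ → F} {R G : ℝ} (hR : 0 < R)
    (h0 : ∀ z, R ≤ ‖z‖ → h z = 0) (hG : ∀ z, ‖h z‖ ≤ G) {w : ℂ} (hw : 2 * R ≤ ‖w‖) :
    ‖cauchyTransformAlong (1 : ℂ) h w‖ ≤ 2 * R ^ 2 * G / ‖w‖ := by
  have hG0 : 0 ≤ G := (norm_nonneg _).trans (hG 0)
  have hw0 : 0 < ‖w‖ := by linarith
  rw [cauchyTransformAlong_one_apply]
  -- the integrand vanishes off `ball w R`
  have hzero : ∀ t ∉ ball w R, ((↑Real.pi * t)⁻¹ : ℂ) • h (w - t) = 0 := by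
    intro t ht
    rw [mem_ball, dist_eq_norm, not_lt, norm_sub_rev] at ht
    rw [h0 (w - t) ht, smul_zero]
  rw [← setIntegral_eq_integral_of_forall_compl_eq_zero hzero]
  have hbound : ∀ t ∈ ball w R,
      ‖((↑Real.pi * t)⁻¹ : ℂ) • h (w - t)‖ ≤ Real.pi⁻¹ * (2 / ‖w‖) * G := by
    intro t ht
    rw [mem_ball, dist_eq_norm, norm_sub_rev] at ht
    have ht' : ‖w‖ / 2 ≤ ‖t‖ := by
      have := norm_sub_norm_le w t
      linarith
    rw [norm_smul, norm_inv, norm_mul, Complex.norm_real, Real.norm_of_nonneg Real.pi_pos.le,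
      mul_inv]
    refine mul_le_mul (mul_le_mul_of_nonneg_left ?_ (by positivity)) (hG _) (norm_nonneg _)
      (by positivity)
    calc ‖t‖⁻¹ ≤ (‖w‖ / 2)⁻¹ := inv_anti₀ (by positivity) ht'
      _ = 2 / ‖w‖ := inv_div _ _
  have hw1 : ‖w‖ ≠ 0 := hw0.ne'
  calc ‖∫ t in ball w R, ((↑Real.pi * t)⁻¹ : ℂ) • h (w - t)‖
      ≤ Real.pi⁻¹ * (2 / ‖w‖) * G * volume.real (ball w R) :=
        norm_setIntegral_le_of_norm_le_const measure_ball_lt_top hbound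
    _ = 2 * R ^ 2 * G / ‖w‖ := by
        have hvol : volume.real (ball w R) = R ^ 2 * Real.pi := by
          simp [Measure.real, Complex.volume_ball, ENNReal.toReal_mul, hR.le]
        rw [hvol]
        field_simp

/-- **The Cauchy transform of a bounded density supported in a disc tends to `0` at infinity**
(`‖(T h)(w)‖ ≤ 2 R² G / ‖w‖` for `‖w‖ ≥ 2R`). [folklore] -/
theorem tendsto_cauchyTransform_cocompact {h : ℂ → F} {R G : ℝ} (hR : 0 < R)
    (h0 : ∀ z, R ≤ ‖z‖ → h z = 0) (hG : ∀ z, ‖h z‖ ≤ G) :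
    Tendsto (cauchyTransformAlong (1 : ℂ) h) (cocompact ℂ) (𝓝 0) := by
  rw [tendsto_zero_iff_norm_tendsto_zero]
  have hlim : Tendsto (fun w : ℂ => 2 * R ^ 2 * G / ‖w‖) (cocompact ℂ) (𝓝 0) :=
    tendsto_const_nhds.div_atTop tendsto_norm_cocompact_atTop
  refine squeeze_zero' (Eventually.of_forall fun w => norm_nonneg _) ?_ hlim
  exact (tendsto_norm_cocompact_atTop.eventually_ge_atTop (2 * R)).mono fun w hw =>
    norm_cauchyTransform_le_div_norm hR h0 hG hw

/-- The derivative of a function vanishing for `ρ ≤ ‖z‖` vanishes for `ρ < ‖z‖` (such points lie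
outside `tsupport`). [folklore] -/
theorem fderiv_eq_zero_of_forall_eq_zero {g : ℂ → F} {ρ : ℝ} (hgρ : ∀ z, ρ ≤ ‖z‖ → g z = 0)
    {z : ℂ} (hz : ρ < ‖z‖) : fderiv ℝ g z = 0 := by
  refine fderiv_of_notMem_tsupport ℝ fun h => ?_
  have h' := tsupport_subset_closedBall_of_eq_zero hgρ h
  rw [mem_closedBall, dist_zero_right] at h'
  linarith

end Decay

/-! ### Directional densities and the derivative of the Cauchy transform -/

section Directional

variable {F : Type*} [NormedAddCommGroup F] [NormedSpace ℂ F]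

/-- For `g ∈ C^{k+1,r}_b(ℂ, F)` and a direction `v`, the density `z ↦ Dg(z) v` is in
`C^{k,r}_b` (derivative shift and evaluation at `v`). [folklore] -/
theorem memContDiffHolder_fderiv_apply {k : ℕ} {r : ℝ≥0} (g : ContDiffHolderFunction ℂ F (k + 1) r)
    (v : ℂ) : MemContDiffHolder k r fun z => fderiv ℝ (g : ℂ → F) z v := by
  have h := g.memContDiffHolder.fderiv.clm_comp (ContinuousLinearMap.apply ℝ F v)
  simpa only [ContinuousLinearMap.apply_apply] using h

/-- A small conversion: `‖x‖ ≤ 1 ⇒ ‖x‖ₑ ≤ 1`. [folklore] -/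
theorem enorm_le_one_of_norm_le {X : Type*} [SeminormedAddCommGroup X] {x : X} (h : ‖x‖ ≤ 1) :
    ‖x‖ₑ ≤ 1 := by
  rw [← ofReal_norm, ← ENNReal.ofReal_one]
  exact ENNReal.ofReal_le_ofReal h

/-- **`‖z ↦ Dg(z) v‖_{C^{k,r}} ≤ ‖g‖_{C^{k+1,r}}`** for `‖v‖ ≤ 1`
(`‖Dg‖_{C^{k,r}} ≤ ‖g‖_{C^{k+1,r}}` and the evaluation at `v` has norm `≤ ‖v‖`). [folklore] -/
theorem norm_fderiv_apply_mk_le {k : ℕ} {r : ℝ≥0} (g : ContDiffHolderFunction ℂ F (k + 1) r)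
    {v : ℂ} (hv : ‖v‖ ≤ 1) :
    ‖(⟨fun z => fderiv ℝ (g : ℂ → F) z v, memContDiffHolder_fderiv_apply g v⟩ :
      ContDiffHolderFunction ℂ F k r)‖ ≤ ‖g‖ := by
  set G : ContDiffHolderFunction ℂ F k r := ⟨_, memContDiffHolder_fderiv_apply g v⟩
  have hL : ‖ContinuousLinearMap.apply ℝ F v‖ ≤ 1 := by
    refine ContinuousLinearMap.opNorm_le_bound _ zero_le_one fun f => ?_
    rw [ContinuousLinearMap.apply_apply, one_mul]
    exact (f.le_opNorm v).trans (mul_le_of_le_one_right (norm_nonneg _) hv)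
  have h1 : eContDiffHolderNorm k r (G : ℂ → F) ≤ eContDiffHolderNorm (k + 1) r (g : ℂ → F) :=
    calc eContDiffHolderNorm k r (G : ℂ → F)
        = eContDiffHolderNorm k r
            (fun z => ContinuousLinearMap.apply ℝ F v (fderiv ℝ (g : ℂ → F) z)) := rfl
      _ ≤ ‖ContinuousLinearMap.apply ℝ F v‖ₑ * eContDiffHolderNorm k r (fderiv ℝ (g : ℂ → F)) :=
          eContDiffHolderNorm_clm_comp_le _ (g.contDiff.fderiv_right (m := k) (by norm_cast)) r
      _ ≤ 1 * eContDiffHolderNorm (k + 1) r (g : ℂ → F) :=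
          mul_le_mul' (enorm_le_one_of_norm_le hL) (eContDiffHolderNorm_fderiv_le k r _)
      _ = _ := one_mul _
  rw [← G.ofReal_norm_eq, ← g.ofReal_norm_eq] at h1
  exact (ENNReal.ofReal_le_ofReal_iff (norm_nonneg _)).1 h1

/-- **The derivative of the Cauchy transform through the directional densities.** For
`g ∈ C¹_c(ℂ, F)`, `D(T g)(z) = re(·) • T(Dg 1)(z) + im(·) • T(Dg I)(z)`: an `ℝ`-linear map on
`ℂ` is determined by its values at `1` and `I`, and `D(T g)(z)[w] = T(Dg[w])(z)`
(`fderiv_cauchyTransformAlong_apply`). [folklore] -/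
theorem fderiv_cauchyTransform_eq_smulRight {g : ℂ → F} (hg : ContDiff ℝ 1 g)
    (hgc : HasCompactSupport g) :
    fderiv ℝ (cauchyTransformAlong (1 : ℂ) g) =
      (fun z => ContinuousLinearMap.smulRightL ℝ ℂ F Complex.reCLM
          (cauchyTransformAlong (1 : ℂ) (fun y => fderiv ℝ g y 1) z)) +
        fun z => ContinuousLinearMap.smulRightL ℝ ℂ F Complex.imCLM
          (cauchyTransformAlong (1 : ℂ) (fun y => fderiv ℝ g y I) z) := by
  funext z
  refine ContinuousLinearMap.ext fun w => ?_
  have hw : w.re • (1 : ℂ) + w.im • I = w := by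
    apply Complex.ext <;> simp
  have hlin : fderiv ℝ (cauchyTransformAlong (1 : ℂ) g) z w =
      w.re • fderiv ℝ (cauchyTransformAlong (1 : ℂ) g) z 1 +
        w.im • fderiv ℝ (cauchyTransformAlong (1 : ℂ) g) z I := by
    conv_lhs => rw [← hw]
    rw [map_add, map_smul, map_smul]
  rw [hlin, fderiv_cauchyTransformAlong_apply hg hgc one_ne_zero z 1,
    fderiv_cauchyTransformAlong_apply hg hgc one_ne_zero z I]
  simp only [Pi.add_apply, add_apply, ContinuousLinearMap.smulRightL_apply_apply,
    ContinuousLinearMap.smulRight_apply, Complex.reCLM_apply, Complex.imCLM_apply]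

/-- The rank-one embeddings `f ↦ L(·) • f`, `L ∈ {re, im}`, have norm `≤ 1`. [folklore] -/
theorem enorm_smulRightL_le_one (L : ℂ →L[ℝ] ℝ) (hL : ‖L‖ = 1) :
    ‖ContinuousLinearMap.smulRightL ℝ ℂ F L‖ₑ ≤ 1 := by
  refine enorm_le_one_of_norm_le (ContinuousLinearMap.opNorm_le_bound _ zero_le_one fun f => ?_)
  rw [ContinuousLinearMap.smulRightL_apply_apply, ContinuousLinearMap.norm_smulRight_apply, hL]

end Directional

/-! ### The case `k = 0` -/

/-- **The case `k = 0`**: `T` maps `C^{0,r}_b` densities vanishing for `‖z‖ ≥ ρ` boundedly into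
`C^{1,r}_b`, with `∂̄ (T g) = g` and `T g → 0` at infinity — `cauchyTransform_holder_of_apriori`
with `K₀ = K₁ = ‖g‖_{C^{0,r}}`, read through the `k = 1` dictionary. [folklore] -/
theorem cauchyTransform_contDiffHolder_one (F : Type) [NormedAddCommGroup F] [NormedSpace ℂ F]
    [CompleteSpace F] [FiniteDimensional ℂ F] {r : ℝ≥0} (hr : 0 < r) (hr1 : r < 1)
    (hT : CauchyTransformHolderApriori F r) :
    ∀ ρ : ℝ, 0 < ρ → ∃ C : ℝ, 0 ≤ C ∧ ∀ g : ContDiffHolderFunction ℂ F 0 r,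
      (∀ z, ρ ≤ ‖z‖ → g z = 0) →
      MemContDiffHolder 1 r (cauchyTransformAlong (1 : ℂ) (g : ℂ → F)) ∧
      eContDiffHolderNorm 1 r (cauchyTransformAlong (1 : ℂ) (g : ℂ → F)) ≤
        ENNReal.ofReal (C * ‖g‖) ∧
      (∀ z, dbarAlong (1 : ℂ) (cauchyTransformAlong (1 : ℂ) (g : ℂ → F)) z = g z) ∧
      Tendsto (cauchyTransformAlong (1 : ℂ) (g : ℂ → F)) (cocompact ℂ) (𝓝 0) := by
  intro ρ hρ
  obtain ⟨C, hC0, hC⟩ := cauchyTransform_holder_of_apriori F hr hr1 hT ρ hρ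
  refine ⟨5 * C, by positivity, fun g hgρ => ?_⟩
  have hg0 : ∀ z, ‖g z‖ ≤ ‖g‖ := g.norm_apply_le_norm
  have hg1 : ∀ z z', ‖g z - g z'‖ ≤ ‖g‖ * ‖z - z'‖ ^ (r : ℝ) := fun z z' => by
    have h := g.holderWith_of_zero.dist_le z z'
    rwa [dist_eq_norm, dist_eq_norm, coe_nnnorm] at h
  obtain ⟨h1, h2, h3, h4, h5⟩ :=
    hC g g.continuous hgρ ‖g‖ ‖g‖ (norm_nonneg _) (norm_nonneg _) hg0 hg1
  -- the Hölder constant of `D(T g)`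
  have hHol : HolderWith (C * (‖g‖ + ‖g‖)).toNNReal r
      (fderiv ℝ (cauchyTransformAlong (1 : ℂ) (g : ℂ → F))) :=
    holderWith_of_dist_le fun z z' => by
      rw [dist_eq_norm, dist_eq_norm, Real.coe_toNNReal _ (by positivity)]
      exact h5 z z'
  refine ⟨memContDiffHolder_one_of_bounds h1 h3 h4 hHol, ?_, h2,
    tendsto_cauchyTransform_cocompact hρ hgρ hg0⟩
  calc eContDiffHolderNorm 1 r (cauchyTransformAlong (1 : ℂ) (g : ℂ → F))
      ≤ ENNReal.ofReal (C * ‖g‖) + ENNReal.ofReal (C * (‖g‖ + ‖g‖)) +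
          ENNReal.ofReal (C * (‖g‖ + ‖g‖)) :=
        eContDiffHolderNorm_one_le_of_bounds h3 h4 hHol
    _ = ENNReal.ofReal (5 * C * ‖g‖) := by
        rw [← ENNReal.ofReal_add (by positivity) (by positivity),
          ← ENNReal.ofReal_add (by positivity) (by positivity)]
        congr 1
        ring

/-! ### The induction step -/

/-- **The induction step `k → k + 1`.** If `T` maps `C^{k,r}_b` densities vanishing off every disc
boundedly into `C^{k+1,r}_b` (with `∂̄ T = id` and decay), then it maps `C^{k+1,r}_b` densities
vanishing for `‖z‖ ≥ ρ` boundedly into `C^{k+2,r}_b`: `D(T g) = re • T(Dg 1) + im • T(Dg I)` with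
`Dg 1, Dg I ∈ C^{k,r}_b` vanishing for `‖z‖ ≥ 2ρ`, plus the sup bound `‖T g‖ ≤ 6 ρ ‖g‖`.
[folklore] -/
theorem cauchyTransform_contDiffHolder_step (F : Type) [NormedAddCommGroup F] [NormedSpace ℂ F]
    [CompleteSpace F] {r : ℝ≥0} {k : ℕ}
    (ih : ∀ ρ : ℝ, 0 < ρ → ∃ C : ℝ, 0 ≤ C ∧ ∀ g : ContDiffHolderFunction ℂ F k r,
      (∀ z, ρ ≤ ‖z‖ → g z = 0) →
      MemContDiffHolder (k + 1) r (cauchyTransformAlong (1 : ℂ) (g : ℂ → F)) ∧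
      eContDiffHolderNorm (k + 1) r (cauchyTransformAlong (1 : ℂ) (g : ℂ → F)) ≤
        ENNReal.ofReal (C * ‖g‖) ∧
      (∀ z, dbarAlong (1 : ℂ) (cauchyTransformAlong (1 : ℂ) (g : ℂ → F)) z = g z) ∧
      Tendsto (cauchyTransformAlong (1 : ℂ) (g : ℂ → F)) (cocompact ℂ) (𝓝 0)) :
    ∀ ρ : ℝ, 0 < ρ → ∃ C : ℝ, 0 ≤ C ∧ ∀ g : ContDiffHolderFunction ℂ F (k + 1) r,
      (∀ z, ρ ≤ ‖z‖ → g z = 0) →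
      MemContDiffHolder (k + 1 + 1) r (cauchyTransformAlong (1 : ℂ) (g : ℂ → F)) ∧
      eContDiffHolderNorm (k + 1 + 1) r (cauchyTransformAlong (1 : ℂ) (g : ℂ → F)) ≤
        ENNReal.ofReal (C * ‖g‖) ∧
      (∀ z, dbarAlong (1 : ℂ) (cauchyTransformAlong (1 : ℂ) (g : ℂ → F)) z = g z) ∧
      Tendsto (cauchyTransformAlong (1 : ℂ) (g : ℂ → F)) (cocompact ℂ) (𝓝 0) := by
  intro ρ hρ
  obtain ⟨Cₖ, hCₖ0, hCₖ⟩ := ih (2 * ρ) (by positivity)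
  refine ⟨6 * ρ + 2 * Cₖ, by positivity, fun g hgρ => ?_⟩
  -- basic facts on `g`
  have hg1 : ContDiff ℝ 1 (g : ℂ → F) := g.contDiff.of_le (by norm_cast; omega)
  have hgt : tsupport (g : ℂ → F) ⊆ closedBall (0 : ℂ) ρ :=
    tsupport_subset_closedBall_of_eq_zero hgρ
  have hgc : HasCompactSupport (g : ℂ → F) :=
    IsCompact.of_isClosed_subset (isCompact_closedBall _ _) (isClosed_tsupport _) hgt
  have hg0 : ∀ z, ‖g z‖ ≤ ‖g‖ := g.norm_apply_le_norm
  have hgs : ∀ z, g z ≠ 0 → ‖z‖ < ρ := fun z hz => by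
    by_contra h
    exact hz (hgρ z (not_lt.1 h))
  -- the two directional densities, members of `C^{k,r}_b` vanishing for `‖z‖ ≥ 2ρ`
  set G₁ : ContDiffHolderFunction ℂ F k r :=
    ⟨fun z => fderiv ℝ (g : ℂ → F) z 1, memContDiffHolder_fderiv_apply g 1⟩
  set G₂ : ContDiffHolderFunction ℂ F k r :=
    ⟨fun z => fderiv ℝ (g : ℂ → F) z I, memContDiffHolder_fderiv_apply g I⟩
  have hGρ : ∀ v : ℂ, ∀ z, 2 * ρ ≤ ‖z‖ → fderiv ℝ (g : ℂ → F) z v = 0 := fun v z hz => by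
    rw [fderiv_eq_zero_of_forall_eq_zero hgρ (by linarith), zero_apply]
  obtain ⟨hm₁, hn₁, -, -⟩ := hCₖ G₁ (hGρ 1)
  obtain ⟨hm₂, hn₂, -, -⟩ := hCₖ G₂ (hGρ I)
  have hN₁ : ‖G₁‖ ≤ ‖g‖ := norm_fderiv_apply_mk_le g (by simp)
  have hN₂ : ‖G₂‖ ≤ ‖g‖ := norm_fderiv_apply_mk_le g (by simp)
  -- the derivative of `T g`
  set B₁ : F →L[ℝ] ℂ →L[ℝ] F := ContinuousLinearMap.smulRightL ℝ ℂ F Complex.reCLM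
  set B₂ : F →L[ℝ] ℂ →L[ℝ] F := ContinuousLinearMap.smulRightL ℝ ℂ F Complex.imCLM
  have hD : fderiv ℝ (cauchyTransformAlong (1 : ℂ) (g : ℂ → F)) =
      (fun z => B₁ (cauchyTransformAlong (1 : ℂ) (G₁ : ℂ → F) z)) +
        fun z => B₂ (cauchyTransformAlong (1 : ℂ) (G₂ : ℂ → F) z) :=
    fderiv_cauchyTransform_eq_smulRight hg1 hgc
  have hDm : MemContDiffHolder (k + 1) r (fderiv ℝ (cauchyTransformAlong (1 : ℂ) (g : ℂ → F))) := by
    rw [hD]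
    exact (hm₁.clm_comp B₁).add (hm₂.clm_comp B₂)
  -- the sup bound
  have hsup : ∀ w, ‖cauchyTransformAlong (1 : ℂ) (g : ℂ → F) w‖ ≤ 6 * ρ * ‖g‖ := fun w =>
    norm_cauchyTransform_le_uniform hρ.le (norm_nonneg g) hgs hg0 w
  -- smoothness and membership
  have hTd : Differentiable ℝ (cauchyTransformAlong (1 : ℂ) (g : ℂ → F)) :=
    (contDiff_cauchyTransformAlong (n := 1) hg1 hgc one_ne_zero).differentiable (by simp)
  have hTcd : ContDiff ℝ ((↑(k + 1) : WithTop ℕ∞) + 1)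
      (cauchyTransformAlong (1 : ℂ) (g : ℂ → F)) := by
    rw [contDiff_succ_iff_fderiv]
    exact ⟨hTd, fun h => absurd h (WithTop.natCast_ne_top _), hDm.contDiff⟩
  have hTm : MemContDiffHolder (k + 1 + 1) r (cauchyTransformAlong (1 : ℂ) (g : ℂ → F)) :=
    memContDiffHolder_succ_iff.2
      ⟨hTcd, (eSupNorm_le_ofReal hsup).trans_lt ENNReal.ofReal_lt_top, hDm⟩
  refine ⟨hTm, ?_, fun z => dbarAlong_cauchyTransformAlong hg1 hgc one_ne_zero z,
    tendsto_cauchyTransform_cocompact hρ hgρ hg0⟩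
  -- the norm bound
  have hpart : ∀ {B : F →L[ℝ] ℂ →L[ℝ] F} {G : ContDiffHolderFunction ℂ F k r}, ‖B‖ₑ ≤ 1 →
      MemContDiffHolder (k + 1) r (cauchyTransformAlong (1 : ℂ) (G : ℂ → F)) →
      eContDiffHolderNorm (k + 1) r (cauchyTransformAlong (1 : ℂ) (G : ℂ → F)) ≤
        ENNReal.ofReal (Cₖ * ‖G‖) → ‖G‖ ≤ ‖g‖ →
      eContDiffHolderNorm (k + 1) r (fun z => B (cauchyTransformAlong (1 : ℂ) (G : ℂ → F) z)) ≤
        ENNReal.ofReal (Cₖ * ‖g‖) := by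
    intro B G hB hm hn hN
    calc eContDiffHolderNorm (k + 1) r (fun z => B (cauchyTransformAlong (1 : ℂ) (G : ℂ → F) z))
        ≤ ‖B‖ₑ * eContDiffHolderNorm (k + 1) r (cauchyTransformAlong (1 : ℂ) (G : ℂ → F)) :=
          eContDiffHolderNorm_clm_comp_le B hm.contDiff r
      _ ≤ 1 * ENNReal.ofReal (Cₖ * ‖g‖) :=
          mul_le_mul' hB (hn.trans (ENNReal.ofReal_le_ofReal (mul_le_mul_of_nonneg_left hN hCₖ0)))
      _ = _ := one_mul _
  calc eContDiffHolderNorm (k + 1 + 1) r (cauchyTransformAlong (1 : ℂ) (g : ℂ → F))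
      = eSupNorm (cauchyTransformAlong (1 : ℂ) (g : ℂ → F)) +
          eContDiffHolderNorm (k + 1) r (fderiv ℝ (cauchyTransformAlong (1 : ℂ) (g : ℂ → F))) :=
        eContDiffHolderNorm_succ_eq_fderiv _ r _
    _ ≤ ENNReal.ofReal (6 * ρ * ‖g‖) + (ENNReal.ofReal (Cₖ * ‖g‖) + ENNReal.ofReal (Cₖ * ‖g‖)) := by
        refine add_le_add (eSupNorm_le_ofReal hsup) ?_
        rw [hD]
        exact (eContDiffHolderNorm_add_le (hm₁.clm_comp B₁).contDiff
          (hm₂.clm_comp B₂).contDiff).trans (add_le_add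
            (hpart (enorm_smulRightL_le_one _ Complex.reCLM_norm) hm₁ hn₁ hN₁)
            (hpart (enorm_smulRightL_le_one _ Complex.imCLM_norm) hm₂ hn₂ hN₂))
    _ = ENNReal.ofReal ((6 * ρ + 2 * Cₖ) * ‖g‖) := by
        rw [← ENNReal.ofReal_add (by positivity) (by positivity),
          ← ENNReal.ofReal_add (by positivity) (by positivity)]
        congr 1
        ring

/-! ### The theorem -/

/-- **The Cauchy transform `C^{k,r}_c → C^{k+1,r}_b`.** Let `F` be a finite-dimensional complex
Banach space, `0 < r < 1`, and assume the a priori `C^{1,r}` estimate for smooth densities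
(`CauchyTransformHolderApriori F r`). Then for every `k : ℕ` and `ρ > 0` there is `C ≥ 0` such
that for every `g ∈ C^{k,r}_b(ℂ, F)` vanishing for `‖z‖ ≥ ρ`: `T g ∈ C^{k+1,r}_b` with
`‖T g‖_{C^{k+1,r}} ≤ C ‖g‖_{C^{k,r}}`, `∂̄ (T g) = g`, and `T g → 0` at infinity (Vekua 1962,
Ch. I, §5–§6 for `k = 0`; induction on `k` by differentiating under the integral sign).
[folklore] -/
theorem cauchyTransform_contDiffHolder_succ (F : Type) [NormedAddCommGroup F] [NormedSpace ℂ F]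
    [CompleteSpace F] [FiniteDimensional ℂ F] {r : ℝ≥0} (hr : 0 < r) (hr1 : r < 1)
    (hT : CauchyTransformHolderApriori F r) (k : ℕ) :
    ∀ ρ : ℝ, 0 < ρ → ∃ C : ℝ, 0 ≤ C ∧ ∀ g : ContDiffHolderFunction ℂ F k r,
      (∀ z, ρ ≤ ‖z‖ → g z = 0) →
      MemContDiffHolder (k + 1) r (cauchyTransformAlong (1 : ℂ) (g : ℂ → F)) ∧
      eContDiffHolderNorm (k + 1) r (cauchyTransformAlong (1 : ℂ) (g : ℂ → F)) ≤
        ENNReal.ofReal (C * ‖g‖) ∧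
      (∀ z, dbarAlong (1 : ℂ) (cauchyTransformAlong (1 : ℂ) (g : ℂ → F)) z = g z) ∧
      Tendsto (cauchyTransformAlong (1 : ℂ) (g : ℂ → F)) (cocompact ℂ) (𝓝 0) := by
  induction k with
  | zero => exact cauchyTransform_contDiffHolder_one F hr hr1 hT
  | succ k ih => exact cauchyTransform_contDiffHolder_step F ih

end Literature.Analysis.Complex

end
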